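import Literature.AlgebraicGeometry.Motives.HodgeThetaSubalgebraUnitaryLeviKernel
import HarnessLib

/-!
# Full Levi algebras as HYPOTHESES: the concrete Levi algebra of an involution, a rank-one raising operator from a
# full larger-side Levi algebra, and from a full smaller-side Levi algebra at maximal rank
# (Ribet 1983 Thm. 3, Lie step — the «double Levi» route, part III)

Family `hodge`, layer `Literature/AlgebraicGeometry/Motives` (pure linear algebra over `ℂ`; no geometry). Research
context: cell `pub-hodge-ring2` (HONEST FRAMING: research route conditional on HC_CM; not a corollary; Q11.4-sentence-2
already refuted in dim ≥ 3), Literature lane gen 85, programme R72. UNCONDITIONAL; theorems only, no definition, no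
named fact (D-0026), no `sorry`. Sequel of `HodgeThetaSubalgebraUnitaryLeviKernel` (R70).

WHY. The R70 tools (`UnitaryLeviKernel.exists_rankOne_raise_of_core`, `UnitaryPencil.exists_pencil_of_core`,
`UnitaryRaisingRankPsi`) consume an ABSTRACT CORE SCHEMA for the Levi type `(ρ | b − ρ)` resp. `(a − ρ | ρ)`: «every
irreducible adjoint-closed graded algebra of that type is full». At the residual stalls of the census (lit-g85 README
§HEIRS: `(8,21)`, `(10,21)`, `(9,10)`, …) those types — `(6 | 15)`, `(2 | 6)`, `(3 | 6)` — are NOT cores (non-full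
irreducible algebras of these types exist), so fullness of the CONCRETE Levi algebra has to be established from inside
(by a double-Levi argument applied to the Levi algebra itself) and then consumed as a HYPOTHESIS. This file provides the
hypothesis versions.

* §1 **`UnitaryLeviFull.levi_axioms`** — the concrete Levi algebra `𝔩 = {Z|_U : Z ∈ 𝔊, ZΘ₁ = Θ₁Z}` on `U = {Θ₁ = −1}`
  (membership characterisation as in `UnitaryLeviKernel.exists_kernel_levi`) satisfies all the axioms of the unitary
  setting: bracket-closed, irreducible (`UnitaryTwoOdd.levi_irreducible`), contains the involution `Θ₂|_U` and `1`,
  Hermitian data, adjoint-closed; with the restriction map. (The content of `UnitaryThreeCoprime.levi_instance`, exported.)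
* §2 **`UnitaryLeviFull.exists_rankOne_raise_of_full`** — for ANY involution `ι` commuting with `Θ` whose Levi algebra on
  `U⁻ = {ι = −1}` is FULL, with `dim U⁻ > dim U⁺`, `dim U⁻ ≥ 3` and both `P ∩ U⁻`, `Q ∩ U⁻` non-zero, `𝔊` contains a
  RANK-ONE RAISING operator (Goursat: the Levi kernel ideal `I⁻` has `dim ≥ b² − a² ≥ 2`, is `ad`-stable, hence contains
  `u ⊗ α`; R70 §4 verbatim with the core replaced by the hypothesis).
* §3 **`UnitaryLeviFull.exists_raise_commute_apply_ne_zero`** — for an involution `ι ∈ 𝔊` commuting with `Θ` with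
  `P ∩ U⁺ ≠ 0 ≠ Q ∩ U⁺`, some raising operator of `𝔊` commuting with `ι` is non-zero on `Q ∩ U⁺` (irreducibility of the
  Levi algebra on `U⁺`).
* §5 **`UnitaryLeviFull.exists_apply_eq_of_maxRank`** — the maximality identity of §4 exported on its own (for raising
  `Y ∈ 𝔷` and `q ∈ Q ∩ U⁻`: `Yq = Bc`, `Yc = 0` with `c ∈ Q ∩ U⁺`), for use at stalls where `L⁺` is not full.
* §4 **`UnitaryLeviFull.exists_raise_lift`**, **`UnitaryLeviFull.exists_rankOne_raise_of_maxRank`** — THE MAXIMALITY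
  POLARISATION. Let `B` be a raising operator of MAXIMAL rank `r` with involution `ι` (`U⁻ ⊇ B(W)`, `Q ∩ U⁻ = Q ∩ ker B`),
  and suppose the Levi algebra on the SMALLER side `U⁺` is full. Every `e ⊗ φ` (`e ∈ P ∩ U⁺`, `φ` a functional on
  `Q ∩ U⁺`) lifts to a raising `X ∈ 𝔊` commuting with `ι` with `X|_{Q ∩ U⁺} = e ⊗ φ` (§4a). Maximality of `r` gives, for
  every raising `Y` commuting with `ι` and every `q ∈ Q ∩ U⁻`, some `c ∈ Q ∩ U⁺` with `Yq = Bc` and `Yc = 0`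
  (`rk(B + Y) ≤ r` and `B + Y` is injective on `Q ∩ U⁺`). If `P ∩ U⁺` contains two independent vectors `e₁, e₂`, applying
  this to `X = lift(e₂ ⊗ ψ)`, `X' = lift(e₁ ⊗ ψ')` (`ψ'(c) = 1`) and `X + X'` forces `Xq = 0`: so `X` IS the rank-one
  operator `e₂ ⊗ ψ`. Hence: **maximal rank `r`, `a − r ≥ 2`, smaller-side Levi full ⟹ a rank-one raising operator** — the
  hypothesis version of the Ψ-core route, usable recursively.

## References
* [Ribet1983] K. A. Ribet, *Hodge classes on certain types of abelian varieties*, Amer. J. Math. 105 (1983), Thm. 3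
  (= [Gordon1997, Thm. 6.3 (3)], pp. 18–19).
* [Deligne1982HodgeCycles] P. Deligne, *Hodge cycles on abelian varieties*, LNM 900 (1982), I §3 Prop. 3.4, 3.6.
* [GoodmanWallachGTM255] R. Goodman, N. R. Wallach, GTM 255 (2009), §4.1.1 (gradings, centralisers of involutions).
* [Humphreys1972] J. E. Humphreys, *Introduction to Lie Algebras and Representation Theory*, §19.1, §4.1.
* [HoffmanKunze1971LinearAlgebra] K. Hoffman, R. Kunze, *Linear Algebra* (1971), §6.7 (projections), §3.5–3.6.
-/

noncomputable section

open Module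

namespace Literature.AlgebraicGeometry.Motives

namespace HodgeStructure

universe u

variable {W : Type u} [AddCommGroup W] [Module ℂ W]

/-! ### §1 The concrete Levi algebra of an involution satisfies the unitary axioms -/

/-- **The concrete Levi algebra satisfies the axioms.** For commuting involutions `Θ₁, Θ₂ ∈ 𝔊` (`Θ₁` self-adjoint) and
`U = {Θ₁ = −1} = PU ⊕ QU` (`Θ₂ = ±1`, orthogonal, definite), the algebra `𝔩 = {Z|_U : Z ∈ 𝔊, ZΘ₁ = Θ₁Z}` is
bracket-closed, irreducible, contains `Θ₂|_U` and `1`, and is adjoint-closed for `s|_U`. (Exported form of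
`UnitaryThreeCoprime.levi_instance`.) [cite: GoodmanWallachGTM255, §4.1.1] [cite: Deligne1982HodgeCycles, I §3 Prop. 3.6]
[cite: Humphreys1972, §19.1] -/
theorem UnitaryLeviFull.levi_axioms [FiniteDimensional ℂ W] {𝔊 : Submodule ℂ (Module.End ℂ W)}
    (hbr : ∀ Y ∈ 𝔊, ∀ Z ∈ 𝔊, Y * Z - Z * Y ∈ 𝔊)
    (hirr : ∀ U : Submodule ℂ W, (∀ A ∈ 𝔊, ∀ u ∈ U, A u ∈ U) → U = ⊥ ∨ U = ⊤)
    {Θ : Module.End ℂ W} (hΘΘ : Θ * Θ = 1)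
    {P Q : Submodule ℂ W} (hP : ∀ x, x ∈ P ↔ Θ x = x) (hQ : ∀ x, x ∈ Q ↔ Θ x = -x)
    {s : W → W → ℂ} (hadd : ∀ x y z, s (x + y) z = s x z + s y z) (hsymm : ∀ x y, s y x = starRingEnd ℂ (s x y))
    (hPQ : ∀ p ∈ P, ∀ q ∈ Q, s p q = 0) (hdefP : ∀ p ∈ P, s p p = 0 → p = 0) (hdefQ : ∀ q ∈ Q, s q q = 0 → q = 0)
    (hadj : ∀ X ∈ 𝔊, ∃ Y ∈ 𝔊, ∀ x y, s (X x) y = s x (Y y))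
    {Θ₁ Θ₂ : Module.End ℂ W} (hΘ₁ : Θ₁ ∈ 𝔊) (hΘ₁Θ₁ : Θ₁ * Θ₁ = 1) (hΘ₁s : ∀ x y, s (Θ₁ x) y = s x (Θ₁ y))
    (hΘ₂ : Θ₂ ∈ 𝔊) (hΘ₂Θ₂ : Θ₂ * Θ₂ = 1) (h12 : Θ₁ * Θ₂ = Θ₂ * Θ₁)
    {U : Submodule ℂ W} (hU : ∀ x, x ∈ U ↔ Θ₁ x = -x)
    {PU QU : Submodule ℂ W} (hPUle : PU ≤ U) (hQUle : QU ≤ U)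
    (hPUmem : ∀ x ∈ U, Θ₂ x = x → x ∈ PU) (hPUΘ₂ : ∀ x ∈ PU, Θ₂ x = x)
    (hQUmem : ∀ x ∈ U, Θ₂ x = -x → x ∈ QU) (hQUΘ₂ : ∀ x ∈ QU, Θ₂ x = -x)
    (hPUQU : ∀ x ∈ PU, ∀ y ∈ QU, s x y = 0) (hdefPU : ∀ x ∈ PU, s x x = 0 → x = 0)
    (hdefQU : ∀ y ∈ QU, s y y = 0 → y = 0)
    {𝔩 : Submodule ℂ (Module.End ℂ U)}
    (h𝔩 : ∀ A, A ∈ 𝔩 ↔ ∃ Z ∈ 𝔊, Z * Θ₁ = Θ₁ * Z ∧ ∀ x : U, ((A x : U) : W) = Z x) :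
    ∃ (ι : Module.End ℂ U) (P' Q' : Submodule ℂ U),
      (∀ x : U, ((ι x : U) : W) = Θ₂ x) ∧
      (∀ x : U, x ∈ P' ↔ (x : W) ∈ PU) ∧ (∀ x : U, x ∈ Q' ↔ (x : W) ∈ QU) ∧
      (∀ A ∈ 𝔩, ∀ A' ∈ 𝔩, A * A' - A' * A ∈ 𝔩) ∧
      (∀ V : Submodule ℂ U, (∀ A ∈ 𝔩, ∀ u ∈ V, A u ∈ V) → V = ⊥ ∨ V = ⊤) ∧
      ι ∈ 𝔩 ∧ ι * ι = 1 ∧ (∀ x, x ∈ P' ↔ ι x = x) ∧ (∀ x, x ∈ Q' ↔ ι x = -x) ∧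
      Module.finrank ℂ P' = Module.finrank ℂ PU ∧ Module.finrank ℂ Q' = Module.finrank ℂ QU ∧
      (∀ p ∈ P', ∀ q ∈ Q', s (p : W) q = 0) ∧ (∀ p ∈ P', s (p : W) p = 0 → p = 0) ∧
      (∀ q ∈ Q', s (q : W) q = 0 → q = 0) ∧
      (∀ A ∈ 𝔩, ∃ A' ∈ 𝔩, ∀ x y : U, s ((A x : U) : W) y = s x ((A' y : U) : W)) ∧
      (∀ Z ∈ 𝔊, Z * Θ₁ = Θ₁ * Z → ∃ A ∈ 𝔩, ∀ x : U, ((A x : U) : W) = Z x) ∧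
      (1 : Module.End ℂ U) ∈ 𝔩 := by
  classical
  obtain ⟨haddr, h0r, h0l, hnegr, hnegl, hsubr, hsubl⟩ := UnitaryTwoOdd.herm_right hadd hsymm
  have hΘ₂v : ∀ v, Θ₂ (Θ₂ v) = v := fun v => by rw [← Module.End.mul_apply, hΘ₂Θ₂, Module.End.one_apply]
  -- the `+1`-eigenspace of `Θ₁`
  set Up : Submodule ℂ W := LinearMap.ker (Θ₁ - 1) with hUpdef
  have hUp : ∀ x, x ∈ Up ↔ Θ₁ x = x := fun x => by
    rw [hUpdef, LinearMap.mem_ker, LinearMap.sub_apply, Module.End.one_apply, sub_eq_zero]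
  have hcommU : ∀ Z : Module.End ℂ W, Z * Θ₁ = Θ₁ * Z → ∀ x ∈ U, Z x ∈ U := fun Z hZ x hx =>
    (hU _).2 (by rw [← Module.End.mul_apply, ← hZ, Module.End.mul_apply, (hU x).1 hx, map_neg])
  have hres : ∀ Z ∈ 𝔊, Z * Θ₁ = Θ₁ * Z → ∃ A ∈ 𝔩, ∀ x : U, ((A x : U) : W) = Z x := fun Z hZ hZΘ =>
    ⟨Z.restrict fun x hx => hcommU Z hZΘ x hx, (h𝔩 _).2 ⟨Z, hZ, hZΘ, fun x => rfl⟩, fun x => rfl⟩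
  have hbr𝔩 : ∀ A ∈ 𝔩, ∀ A' ∈ 𝔩, A * A' - A' * A ∈ 𝔩 := by
    intro A hA A' hA'
    obtain ⟨Z, hZ, hZΘ, hAZ⟩ := (h𝔩 A).1 hA
    obtain ⟨Z', hZ', hZ'Θ, hAZ'⟩ := (h𝔩 A').1 hA'
    refine (h𝔩 _).2 ⟨Z * Z' - Z' * Z, hbr Z hZ Z' hZ', ?_, fun x => ?_⟩
    · rw [sub_mul, mul_sub, mul_assoc, hZ'Θ, ← mul_assoc, hZΘ, mul_assoc, mul_assoc, hZΘ, ← mul_assoc Z', hZ'Θ,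
        mul_assoc]
    · rw [LinearMap.sub_apply, Submodule.coe_sub, Module.End.mul_apply, Module.End.mul_apply, hAZ, hAZ', hAZ', hAZ,
        LinearMap.sub_apply, Module.End.mul_apply, Module.End.mul_apply]
  have hirr𝔩 := UnitaryTwoOdd.levi_irreducible hbr hirr hΘ₁ hΘ₁Θ₁ hUp hU 𝔩 hres
  -- the involution `ι = Θ₂|_U`
  set ι : Module.End ℂ U := Θ₂.restrict fun x hx => hcommU Θ₂ h12.symm x hx with hιdef
  have hιapply : ∀ x : U, ((ι x : U) : W) = Θ₂ x := fun x => rfl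
  have hι : ι ∈ 𝔩 := (h𝔩 ι).2 ⟨Θ₂, hΘ₂, h12.symm, hιapply⟩
  have hιι : ι * ι = 1 := LinearMap.ext fun x => Subtype.ext (by
    rw [Module.End.mul_apply, Module.End.one_apply, hιapply, hιapply, hΘ₂v])
  set P' : Submodule ℂ U := Submodule.comap U.subtype PU with hP'def
  set Q' : Submodule ℂ U := Submodule.comap U.subtype QU with hQ'def
  have hP'mem : ∀ x : U, x ∈ P' ↔ (x : W) ∈ PU := fun x => by
    rw [hP'def, Submodule.mem_comap, Submodule.subtype_apply]
  have hQ'mem : ∀ x : U, x ∈ Q' ↔ (x : W) ∈ QU := fun x => by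
    rw [hQ'def, Submodule.mem_comap, Submodule.subtype_apply]
  have hP' : ∀ x, x ∈ P' ↔ ι x = x := fun x => by
    rw [hP'mem]
    constructor
    · intro h; exact Subtype.ext (by rw [hιapply, hPUΘ₂ _ h])
    · intro h; exact hPUmem _ x.2 (by rw [← hιapply, h])
  have hQ' : ∀ x, x ∈ Q' ↔ ι x = -x := fun x => by
    rw [hQ'mem]
    constructor
    · intro h; exact Subtype.ext (by rw [hιapply, hQUΘ₂ _ h, Submodule.coe_neg])
    · intro h; exact hQUmem _ x.2 (by rw [← hιapply, h, Submodule.coe_neg])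
  have hfinP' : Module.finrank ℂ P' = Module.finrank ℂ PU := by
    rw [hP'def, (Submodule.comapSubtypeEquivOfLe hPUle).finrank_eq]
  have hfinQ' : Module.finrank ℂ Q' = Module.finrank ℂ QU := by
    rw [hQ'def, (Submodule.comapSubtypeEquivOfLe hQUle).finrank_eq]
  have hP'Q' : ∀ p ∈ P', ∀ q ∈ Q', s (p : W) q = 0 := fun p hp q hq =>
    hPUQU _ ((hP'mem p).1 hp) _ ((hQ'mem q).1 hq)
  have hdefP' : ∀ p ∈ P', s (p : W) p = 0 → p = 0 := fun p hp h =>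
    Subtype.ext (hdefPU _ ((hP'mem p).1 hp) h)
  have hdefQ' : ∀ q ∈ Q', s (q : W) q = 0 → q = 0 := fun q hq h =>
    Subtype.ext (hdefQU _ ((hQ'mem q).1 hq) h)
  -- adjoints
  have hadj𝔩 : ∀ A ∈ 𝔩, ∃ A' ∈ 𝔩, ∀ x y : U, s ((A x : U) : W) y = s x ((A' y : U) : W) := by
    intro A hA
    obtain ⟨Z, hZ, hZΘ, hAZ⟩ := (h𝔩 A).1 hA
    obtain ⟨Z', hZ', hZZ'⟩ := hadj Z hZ
    have hZ'Θ : Z' * Θ₁ = Θ₁ * Z' := by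
      refine LinearMap.ext fun y => ?_
      rw [← sub_eq_zero, ← LinearMap.sub_apply]
      refine UnitaryTwoOdd.eq_zero_of_forall_left hadd hsymm hΘΘ hP hQ hPQ hdefP hdefQ fun x => ?_
      rw [LinearMap.sub_apply, hsubr, Module.End.mul_apply, Module.End.mul_apply, ← hZZ', ← hΘ₁s, ← hΘ₁s, ← hZZ',
        ← Module.End.mul_apply, ← Module.End.mul_apply, hZΘ, sub_self]
    obtain ⟨A', hA', hA'Z'⟩ := hres Z' hZ' hZ'Θ
    exact ⟨A', hA', fun x y => by rw [hAZ, hA'Z', hZZ']⟩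
  -- `1 = (−Θ₁)|_U ∈ 𝔩`
  have h1 : (1 : Module.End ℂ U) ∈ 𝔩 :=
    (h𝔩 1).2 ⟨-Θ₁, Submodule.neg_mem _ hΘ₁, by rw [neg_mul, mul_neg], fun x => by
      rw [Module.End.one_apply, LinearMap.neg_apply, (hU x).1 x.2, neg_neg]⟩
  exact ⟨ι, P', Q', hιapply, hP'mem, hQ'mem, hbr𝔩, hirr𝔩, hι, hιι, hP', hQ', hfinP', hfinQ', hP'Q', hdefP', hdefQ',
    hadj𝔩, hres, h1⟩

/-! ### §2 A rank-one raising operator from a FULL Levi algebra on the larger side -/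

/-- **A full larger-side Levi algebra yields a rank-one raising operator (hypothesis version of
`UnitaryLeviKernel.exists_rankOne_raise_of_core`).** Let `ι` be an involution commuting with `Θ`, `U^∓ = {ι = ∓1}`, with
`dim U⁻ > dim U⁺`, `dim U⁻ ≥ 3`, `u ∈ P ∩ U⁻` and `q₀ ∈ Q ∩ U⁻` non-zero. If the Levi algebra of `𝔊` on `U⁻` is full,
then `𝔊` contains a raising operator of rank one: the Levi kernel ideal `I⁻` has `dim ≥ (dim U⁻)² − (dim U⁺)² ≥ 2`
(Goursat), is `ad(End U⁻)`-stable, so contains `u ⊗ α` with `α = μ ∘ π_Q`, `μ(q₀) = 1`; its zero extension is raising.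
[cite: Ribet1983, Thm. 3] [cite: Humphreys1972, §19.1] [cite: Deligne1982HodgeCycles, I §3 Prop. 3.6]
[cite: GoodmanWallachGTM255, §4.1.1] -/
theorem UnitaryLeviFull.exists_rankOne_raise_of_full [FiniteDimensional ℂ W] {𝔊 : Submodule ℂ (Module.End ℂ W)}
    (hbr : ∀ Y ∈ 𝔊, ∀ Z ∈ 𝔊, Y * Z - Z * Y ∈ 𝔊)
    {Θ : Module.End ℂ W} (hΘΘ : Θ * Θ = 1)
    {ι : Module.End ℂ W} (hιι : ι * ι = 1) (hιΘ : ι * Θ = Θ * ι)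
    {Um Up : Submodule ℂ W} (hUm : ∀ x, x ∈ Um ↔ ι x = -x) (hUp : ∀ x, x ∈ Up ↔ ι x = x)
    (hfull : ∀ T : Module.End ℂ Um, ∃ Z ∈ 𝔊, Z * ι = ι * Z ∧ ∀ x : Um, ((T x : Um) : W) = Z x)
    (h3 : 3 ≤ Module.finrank ℂ Um) (hab : Module.finrank ℂ Up < Module.finrank ℂ Um)
    {u : W} (hΘu : Θ u = u) (hιu : ι u = -u) (hu0 : u ≠ 0)
    {q₀ : W} (hΘq₀ : Θ q₀ = -q₀) (hιq₀ : ι q₀ = -q₀) (hq₀0 : q₀ ≠ 0) :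
    ∃ B₁ ∈ 𝔊, Θ * B₁ = B₁ ∧ B₁ * Θ = -B₁ ∧ Module.finrank ℂ (LinearMap.range B₁) = 1 := by
  classical
  have hΘΘv : ∀ v, Θ (Θ v) = v := fun v => by rw [← Module.End.mul_apply, hΘΘ, Module.End.one_apply]
  have hιv : ∀ v, ι (ι v) = v := fun v => by rw [← Module.End.mul_apply, hιι, Module.End.one_apply]
  have hιΘv : ∀ w, ι (Θ w) = Θ (ι w) := fun w => by rw [← Module.End.mul_apply, hιΘ, Module.End.mul_apply]
  -- the Levi kernel ideal `I⁻`: dimension `≥ b² − a² ≥ 2`, `ad`-stable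
  obtain ⟨Im, Ip, Lm, Lp, hIm, -, hLm, hLp, hdim⟩ := UnitaryLeviKernel.exists_kernel_levi 𝔊 hιι hUm hUp
  obtain ⟨-, hLmfull⟩ := UnitaryLeviKernel.finrank_levi hLm
  have hLmdim := hLmfull hfull
  obtain ⟨hLpdim, -⟩ := UnitaryLeviKernel.finrank_levi hLp
  have hsq : Module.finrank ℂ Up * Module.finrank ℂ Up + 2 ≤ Module.finrank ℂ Um * Module.finrank ℂ Um := by
    have h1 : Module.finrank ℂ Up * Module.finrank ℂ Up ≤ Module.finrank ℂ Up * Module.finrank ℂ Um :=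
      Nat.mul_le_mul le_rfl hab.le
    have h2 : (Module.finrank ℂ Up + 1) * Module.finrank ℂ Um ≤ Module.finrank ℂ Um * Module.finrank ℂ Um :=
      Nat.mul_le_mul (Nat.succ_le_of_lt hab) le_rfl
    have e : (Module.finrank ℂ Up + 1) * Module.finrank ℂ Um =
        Module.finrank ℂ Up * Module.finrank ℂ Um + Module.finrank ℂ Um := by ring
    omega
  have hIm2 : 2 ≤ Module.finrank ℂ Im := by omega
  have had := UnitaryLeviKernel.kernel_adStable hbr hUp hIm hfull
  obtain ⟨N, hN, hNs⟩ := UnitaryAdStable.exists_not_scalar_of_two_le_finrank Im hIm2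
  obtain ⟨w, hw⟩ := UnitaryAdStable.exists_apply_not_mem_span N hNs
  -- the functional `α = μ ∘ π_Q` on `U⁻`
  obtain ⟨μ, hμ⟩ := Module.Projective.exists_dual_eq_one ℂ hq₀0
  set πQ : Module.End ℂ W := (2 : ℂ)⁻¹ • (1 - Θ) with hπQdef
  have hπQapply : ∀ x, πQ x = (2 : ℂ)⁻¹ • (x - Θ x) := fun x => by
    rw [hπQdef, LinearMap.smul_apply, LinearMap.sub_apply, Module.End.one_apply]
  set α : Module.Dual ℂ Um := (μ ∘ₗ πQ) ∘ₗ Um.subtype with hαdef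
  have hαapply : ∀ x : Um, α x = μ ((2 : ℂ)⁻¹ • ((x : W) - Θ x)) := fun x => by
    rw [hαdef, LinearMap.comp_apply, LinearMap.comp_apply, Submodule.subtype_apply, hπQapply]
  set u' : Um := ⟨u, (hUm u).2 hιu⟩ with hu'def
  have hαu : α u' = 0 := by rw [hαapply, hu'def, hΘu, sub_self, smul_zero, map_zero]
  have hT : α.smulRight u' ∈ Im := UnitaryAdStable.smulRight_mem Im had hN hw h3 u' α hαu
  obtain ⟨Z, hZ, hZval, hZ0⟩ := (hIm _).1 hT
  -- `Z = (α ∘ π⁻) ⊗ u` is a rank-one raising operator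
  have hm : ∀ w, (2 : ℂ)⁻¹ • (w - ι w) ∈ Um := fun w =>
    (hUm _).2 (by rw [map_smul, map_sub, hιv, ← smul_neg, neg_sub])
  have hp : ∀ w, (2 : ℂ)⁻¹ • (w + ι w) ∈ Up := fun w => (hUp _).2 (by rw [map_smul, map_add, hιv, add_comm])
  have hZm : ∀ (x : W) (hx : x ∈ Um), Z x = α ⟨x, hx⟩ • u := fun x hx => by
    have h := hZval ⟨x, hx⟩
    rw [LinearMap.smulRight_apply, Submodule.coe_smul] at h
    exact h.symm
  have hZw : ∀ w, Z w = α ⟨(2 : ℂ)⁻¹ • (w - ι w), hm w⟩ • u := fun w => by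
    have hw' : w = (2 : ℂ)⁻¹ • (w + ι w) + (2 : ℂ)⁻¹ • (w - ι w) := by module
    conv_lhs => rw [hw', map_add, hZ0 _ (hp w), zero_add, hZm _ (hm w)]
  have hΘZ : Θ * Z = Z := LinearMap.ext fun w => by rw [Module.End.mul_apply, hZw, map_smul, hΘu]
  have hZΘ : Z * Θ = -Z := by
    refine LinearMap.ext fun w => ?_
    rw [Module.End.mul_apply, LinearMap.neg_apply, hZw, hZw, ← neg_smul]
    congr 1
    rw [hαapply, hαapply, ← map_neg]
    congr 1
    simp only [hιΘv, map_smul, map_sub, hΘΘv]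
    module
  have hZq₀ : Z q₀ = u := by
    rw [hZm q₀ ((hUm q₀).2 hιq₀), hαapply]
    simp only [hΘq₀, sub_neg_eq_add]
    rw [show (2 : ℂ)⁻¹ • (q₀ + q₀) = q₀ by module, hμ, one_smul]
  have hrange : LinearMap.range Z = ℂ ∙ u := by
    apply le_antisymm
    · rintro _ ⟨w, rfl⟩
      rw [hZw]; exact Submodule.smul_mem _ _ (Submodule.mem_span_singleton_self u)
    · rw [Submodule.span_singleton_le_iff_mem]
      exact ⟨q₀, hZq₀⟩
  refine ⟨Z, hZ, hΘZ, hZΘ, ?_⟩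
  rw [hrange, finrank_span_singleton hu0]

/-! ### §3 A raising operator commuting with `ι`, non-zero on `Q ∩ U⁺` -/

/-- **Some raising operator commuting with `ι` is non-zero on `Q ∩ U⁺`.** For an involution `ι ∈ 𝔊` commuting with
`Θ` with `P ∩ U⁺ ≠ 0` and `Q ∩ U⁺ ≠ 0` (`U⁺ = {ι = 1}`): otherwise `Q ∩ U⁺` would be invariant under the Levi algebra
`L⁺`, which is irreducible on `U⁺` (`UnitaryTwoOdd.levi_irreducible`). [cite: Ribet1983, Thm. 3]
[cite: Deligne1982HodgeCycles, I §3 Prop. 3.4] [cite: GoodmanWallachGTM255, §4.1.1] -/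
theorem UnitaryLeviFull.exists_raise_commute_apply_ne_zero [FiniteDimensional ℂ W]
    {𝔊 : Submodule ℂ (Module.End ℂ W)}
    (hbr : ∀ Y ∈ 𝔊, ∀ Z ∈ 𝔊, Y * Z - Z * Y ∈ 𝔊)
    (hirr : ∀ U : Submodule ℂ W, (∀ A ∈ 𝔊, ∀ u ∈ U, A u ∈ U) → U = ⊥ ∨ U = ⊤)
    {Θ : Module.End ℂ W} (hΘ : Θ ∈ 𝔊) (hΘΘ : Θ * Θ = 1)
    {Q : Submodule ℂ W} (hQ : ∀ x, x ∈ Q ↔ Θ x = -x)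
    {ι : Module.End ℂ W} (hι : ι ∈ 𝔊) (hιι : ι * ι = 1) (hιΘ : ι * Θ = Θ * ι)
    {Um Up : Submodule ℂ W} (hUm : ∀ x, x ∈ Um ↔ ι x = -x) (hUp : ∀ x, x ∈ Up ↔ ι x = x)
    (hp : ∃ p, p ≠ 0 ∧ ι p = p ∧ Θ p = p) (hq : ∃ q, q ≠ 0 ∧ ι q = q ∧ Θ q = -q) :
    ∃ B' ∈ 𝔊, Θ * B' = B' ∧ B' * Θ = -B' ∧ B' * ι = ι * B' ∧ ∃ q, ι q = q ∧ Θ q = -q ∧ B' q ≠ 0 := by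
  classical
  have hΘΘv : ∀ v, Θ (Θ v) = v := fun v => by rw [← Module.End.mul_apply, hΘΘ, Module.End.one_apply]
  have hPhat : ∀ w, Θ ((2 : ℂ)⁻¹ • (w + Θ w)) = (2 : ℂ)⁻¹ • (w + Θ w) := fun w => by
    rw [map_smul, map_add, hΘΘv, add_comm]
  have hsplitΘ : ∀ w, (2 : ℂ)⁻¹ • (w + Θ w) + (2 : ℂ)⁻¹ • (w - Θ w) = w := fun w => by module
  obtain ⟨Im, Ip, Lm, Lp, -, -, -, hLp, -⟩ := UnitaryLeviKernel.exists_kernel_levi 𝔊 hιι hUm hUp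
  have hnι : -ι ∈ 𝔊 := Submodule.neg_mem _ hι
  have hnιι : (-ι) * (-ι) = 1 := by rw [neg_mul_neg, hιι]
  have hUm' : ∀ x, x ∈ Um ↔ (-ι) x = x := fun x => by rw [hUm, LinearMap.neg_apply, neg_eq_iff_eq_neg]
  have hUp' : ∀ x, x ∈ Up ↔ (-ι) x = -x := fun x => by rw [hUp, LinearMap.neg_apply, neg_inj]
  have hcp : ∀ Z : Module.End ℂ W, Z * ι = ι * Z → ∀ x ∈ Up, Z x ∈ Up := fun Z hZ x hx =>
    (hUp _).2 (by rw [← Module.End.mul_apply, ← hZ, Module.End.mul_apply, (hUp x).1 hx])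
  have hres : ∀ Z ∈ 𝔊, Z * (-ι) = (-ι) * Z → ∃ A ∈ Lp, ∀ q : Up, ((A q : Up) : W) = Z q := fun Z hZ hZc => by
    have hZc' : Z * ι = ι * Z := by rw [mul_neg, neg_mul, neg_inj] at hZc; exact hZc
    exact ⟨Z.restrict fun x hx => hcp Z hZc' x hx, (hLp _).2 ⟨Z, hZ, hZc', fun x => rfl⟩, fun x => rfl⟩
  have hirrL := UnitaryTwoOdd.levi_irreducible hbr hirr hnι hnιι hUm' hUp' Lp hres
  by_contra hne
  push Not at hne
  have hall : ∀ Z ∈ 𝔊, Z * ι = ι * Z → ∀ q, ι q = q → Θ q = -q →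
      ((4 : ℂ)⁻¹ • (Z + Θ * Z - Z * Θ - Θ * Z * Θ)) q = 0 := by
    intro Z hZ hZc q hιq hΘq
    set B' : Module.End ℂ W := (4 : ℂ)⁻¹ • (Z + Θ * Z - Z * Θ - Θ * Z * Θ) with hB'def
    have hB'mem : B' ∈ 𝔊 := UnitaryTheta.raise_mem hbr hΘ hΘΘv hZ
    have hΘB' : Θ * B' = B' := LinearMap.ext fun v => UnitaryTheta.apply_raise_apply hΘΘv Z v
    have hB'P : ∀ p, Θ p = p → B' p = 0 := fun p hp => UnitaryTheta.raise_apply_of_eq Θ Z hp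
    have hB'Θ : B' * Θ = -B' := by
      refine LinearMap.ext fun w => ?_
      rw [Module.End.mul_apply, LinearMap.neg_apply]
      have hΘw : Θ w = (2 : ℂ)⁻¹ • (w + Θ w) - (2 : ℂ)⁻¹ • (w - Θ w) := by module
      conv_lhs => rw [hΘw, map_sub, hB'P _ (hPhat w), zero_sub]
      conv_rhs => rw [← hsplitΘ w, map_add, hB'P _ (hPhat w), zero_add]
    have hB'c : B' * ι = ι * B' := UnitaryLeviKernel.raise_commute hιΘ hZc
    exact hne B' hB'mem hΘB' hB'Θ hB'c q hιq hΘq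
  -- the invariant subspace `Q ∩ U⁺ ⊆ U⁺`
  set S : Submodule ℂ Up := Q.comap Up.subtype with hSdef
  have hSmem : ∀ x : Up, x ∈ S ↔ (x : W) ∈ Q := fun x => by rw [hSdef, Submodule.mem_comap, Submodule.subtype_apply]
  have hSinv : ∀ A ∈ Lp, ∀ u ∈ S, A u ∈ S := by
    intro A hA u hu
    obtain ⟨Z, hZ, hZc, hAZ⟩ := (hLp A).1 hA
    rw [hSmem] at hu ⊢
    rw [hAZ]
    have huQ : Θ (u : W) = -(u : W) := (hQ _).1 hu
    have h0 := hall Z hZ hZc u ((hUp _).1 u.2) huQ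
    rw [UnitaryTheta.raise_apply_of_eq_neg Θ Z huQ] at h0
    have h0' : Z u + Θ (Z u) = 0 := by
      have := congrArg (fun v => (2 : ℂ) • v) h0
      simpa using this
    exact (hQ _).2 (by rw [eq_neg_iff_add_eq_zero, add_comm]; exact h0')
  rcases hirrL S hSinv with hS | hS
  · obtain ⟨q, hq0, hιq, hΘq⟩ := hq
    have hqU : q ∈ Up := (hUp q).2 hιq
    have hmem : (⟨q, hqU⟩ : Up) ∈ S := (hSmem _).2 ((hQ q).2 hΘq)
    rw [hS, Submodule.mem_bot] at hmem
    exact hq0 (by simpa using congrArg Subtype.val hmem)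
  · obtain ⟨p, hp0, hιp, hΘp⟩ := hp
    have hpU : p ∈ Up := (hUp p).2 hιp
    have hmem : (⟨p, hpU⟩ : Up) ∈ S := by rw [hS]; exact Submodule.mem_top
    rw [hSmem] at hmem
    have e2 := (hQ p).1 hmem
    rw [hΘp] at e2
    have : (2 : ℂ) • p = 0 := by rw [two_smul]; nth_rewrite 2 [e2]; rw [add_neg_cancel]
    exact hp0 ((smul_eq_zero.1 this).resolve_left two_ne_zero)

/-! ### §4 The maximality polarisation: a rank-one raising operator from a full SMALLER-side Levi algebra -/

/-- **Lifting `e ⊗ φ` through a full Levi algebra on `U⁺`.** If the Levi algebra of `𝔊` on `U⁺ = {ι = 1}` is full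
(`ι` commuting with `Θ`), then for every functional `φ` and every `e ∈ P ∩ U⁺` some raising `X ∈ 𝔊` commutes with `ι`
and satisfies `X q = φ(q) e` for all `q ∈ Q ∩ U⁺` (the raising component of a lift of `(φ|_{U⁺}) ⊗ e`).
[cite: GoodmanWallachGTM255, §4.1.1] [cite: Deligne1982HodgeCycles, I §3 Prop. 3.4] -/
theorem UnitaryLeviFull.exists_raise_lift {𝔊 : Submodule ℂ (Module.End ℂ W)}
    (hbr : ∀ Y ∈ 𝔊, ∀ Z ∈ 𝔊, Y * Z - Z * Y ∈ 𝔊)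
    {Θ : Module.End ℂ W} (hΘ : Θ ∈ 𝔊) (hΘΘ : Θ * Θ = 1)
    {ι : Module.End ℂ W} (hιΘ : ι * Θ = Θ * ι)
    {Up : Submodule ℂ W} (hUp : ∀ x, x ∈ Up ↔ ι x = x)
    (hfull : ∀ T : Module.End ℂ Up, ∃ Z ∈ 𝔊, Z * ι = ι * Z ∧ ∀ x : Up, ((T x : Up) : W) = Z x)
    (φ : Module.Dual ℂ W) {e : W} (hΘe : Θ e = e) (hιe : ι e = e) :
    ∃ X ∈ 𝔊, Θ * X = X ∧ X * Θ = -X ∧ X * ι = ι * X ∧ ∀ q, ι q = q → Θ q = -q → X q = φ q • e := by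
  classical
  have hΘΘv : ∀ v, Θ (Θ v) = v := fun v => by rw [← Module.End.mul_apply, hΘΘ, Module.End.one_apply]
  have hPhat : ∀ w, Θ ((2 : ℂ)⁻¹ • (w + Θ w)) = (2 : ℂ)⁻¹ • (w + Θ w) := fun w => by
    rw [map_smul, map_add, hΘΘv, add_comm]
  have hsplitΘ : ∀ w, (2 : ℂ)⁻¹ • (w + Θ w) + (2 : ℂ)⁻¹ • (w - Θ w) = w := fun w => by module
  set T : Module.End ℂ Up := (φ ∘ₗ Up.subtype).smulRight ⟨e, (hUp e).2 hιe⟩ with hTdef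
  obtain ⟨Z, hZ, hZc, hZT⟩ := hfull T
  have hZval : ∀ x : Up, Z x = φ x • e := fun x => by
    rw [← hZT x, hTdef, LinearMap.smulRight_apply, LinearMap.comp_apply, Submodule.subtype_apply, Submodule.coe_smul]
  set X : Module.End ℂ W := (4 : ℂ)⁻¹ • (Z + Θ * Z - Z * Θ - Θ * Z * Θ) with hXdef
  have hXmem : X ∈ 𝔊 := UnitaryTheta.raise_mem hbr hΘ hΘΘv hZ
  have hΘX : Θ * X = X := LinearMap.ext fun v => UnitaryTheta.apply_raise_apply hΘΘv Z v
  have hXP : ∀ p, Θ p = p → X p = 0 := fun p hp => UnitaryTheta.raise_apply_of_eq Θ Z hp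
  have hXΘ : X * Θ = -X := by
    refine LinearMap.ext fun w => ?_
    rw [Module.End.mul_apply, LinearMap.neg_apply]
    have hΘw : Θ w = (2 : ℂ)⁻¹ • (w + Θ w) - (2 : ℂ)⁻¹ • (w - Θ w) := by module
    conv_lhs => rw [hΘw, map_sub, hXP _ (hPhat w), zero_sub]
    conv_rhs => rw [← hsplitΘ w, map_add, hXP _ (hPhat w), zero_add]
  have hXc : X * ι = ι * X := UnitaryLeviKernel.raise_commute hιΘ hZc
  refine ⟨X, hXmem, hΘX, hXΘ, hXc, fun q hιq hΘq => ?_⟩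
  rw [hXdef, UnitaryTheta.raise_apply_of_eq_neg Θ Z hΘq, hZval ⟨q, (hUp q).2 hιq⟩, map_smul, hΘe]
  module

/-- **THE MAXIMALITY POLARISATION: maximal rank + two independent vectors in `P ∩ U⁺` + full Levi algebra on `U⁺` ⟹ a
rank-one raising operator.** Let `B ∈ 𝔊` be raising of MAXIMAL rank, `ι` an involution commuting with `Θ` with
`B(W) ⊆ U⁻`, `Q ∩ U⁻ ⊆ ker B` and `Q ∩ ker B ⊆ U⁻` (the involution of `B`, `UnitaryLeviKernel.exists_involution`), the
Levi algebra on `U⁺ = {ι = 1}` full, `e₁, e₂ ∈ P ∩ U⁺` independent and `0 ≠ c₁ ∈ Q ∩ U⁺`. Then `𝔊` contains a raising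
operator of rank one — namely the lift `X` of `e₂ ⊗ ψ` (`ψ(c₁) = 1`): for every raising `Y` commuting with `ι` and
`q ∈ Q ∩ U⁻`, maximality gives `c ∈ Q ∩ U⁺` with `Yq = Bc`, `Yc = 0` (`B + Y` is injective on `Q ∩ U⁺`, so
`(B + Y)(Q ∩ U⁺) = (B + Y)(W)`); applied to `X`, to the lift `X'` of `e₁ ⊗ ψ'` (`ψ'(c) = 1`) and to `X + X'` this forces
`Xq = 0`, so `X = e₂ ⊗ ψ` has rank one. [cite: Ribet1983, Thm. 3] [cite: Deligne1982HodgeCycles, I §3 Prop. 3.4, 3.6]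
[cite: GoodmanWallachGTM255, §4.1.1] [cite: HoffmanKunze1971LinearAlgebra, §3.1 Thm. 2] -/
theorem UnitaryLeviFull.exists_rankOne_raise_of_maxRank [FiniteDimensional ℂ W] {𝔊 : Submodule ℂ (Module.End ℂ W)}
    (hbr : ∀ Y ∈ 𝔊, ∀ Z ∈ 𝔊, Y * Z - Z * Y ∈ 𝔊)
    {Θ : Module.End ℂ W} (hΘ : Θ ∈ 𝔊) (hΘΘ : Θ * Θ = 1)
    {B : Module.End ℂ W} (hB : B ∈ 𝔊) (hΘB : Θ * B = B) (hBΘ : B * Θ = -B)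
    (hmax : ∀ B' ∈ 𝔊, Θ * B' = B' → B' * Θ = -B' →
      Module.finrank ℂ (LinearMap.range B') ≤ Module.finrank ℂ (LinearMap.range B))
    {ι : Module.End ℂ W} (hιι : ι * ι = 1) (hιΘ : ι * Θ = Θ * ι) (hιB : ∀ w, ι (B w) = -(B w))
    (hkerB : ∀ x, ι x = -x → Θ x = -x → B x = 0) (hιker : ∀ x, Θ x = -x → B x = 0 → ι x = -x)
    {Up : Submodule ℂ W} (hUp : ∀ x, x ∈ Up ↔ ι x = x)
    (hfull : ∀ T : Module.End ℂ Up, ∃ Z ∈ 𝔊, Z * ι = ι * Z ∧ ∀ x : Up, ((T x : Up) : W) = Z x)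
    {e₁ e₂ : W} (hΘe₁ : Θ e₁ = e₁) (hιe₁ : ι e₁ = e₁) (hΘe₂ : Θ e₂ = e₂) (hιe₂ : ι e₂ = e₂)
    (hind : ∀ a b : ℂ, a • e₁ + b • e₂ = 0 → a = 0 ∧ b = 0)
    {c₁ : W} (hΘc₁ : Θ c₁ = -c₁) (hιc₁ : ι c₁ = c₁) (hc₁0 : c₁ ≠ 0) :
    ∃ B₁ ∈ 𝔊, Θ * B₁ = B₁ ∧ B₁ * Θ = -B₁ ∧ Module.finrank ℂ (LinearMap.range B₁) = 1 := by
  classical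
  have hΘΘv : ∀ v, Θ (Θ v) = v := fun v => by rw [← Module.End.mul_apply, hΘΘ, Module.End.one_apply]
  have hιv : ∀ v, ι (ι v) = v := fun v => by rw [← Module.End.mul_apply, hιι, Module.End.one_apply]
  have hιΘv : ∀ w, ι (Θ w) = Θ (ι w) := fun w => by rw [← Module.End.mul_apply, hιΘ, Module.End.mul_apply]
  have he₁0 : e₁ ≠ 0 := fun h =>
    one_ne_zero (hind 1 0 (by rw [h, smul_zero, zero_smul, add_zero])).1
  have he₂0 : e₂ ≠ 0 := fun h =>
    one_ne_zero (hind 0 1 (by rw [h, smul_zero, zero_smul, zero_add])).2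
  have hraiseP : ∀ Y : Module.End ℂ W, Y * Θ = -Y → ∀ p, Θ p = p → Y p = 0 := fun Y hYΘ p hp => by
    have h : Y p = -(Y p) := by
      conv_lhs => rw [← hp]
      rw [← Module.End.mul_apply, hYΘ, LinearMap.neg_apply]
    have h2 : (2 : ℂ) • Y p = 0 := by rw [two_smul]; nth_rewrite 2 [h]; rw [add_neg_cancel]
    exact (smul_eq_zero.1 h2).resolve_left two_ne_zero
  -- `Q₁ = Q ∩ U⁺`
  set Q₁ : Submodule ℂ W := LinearMap.ker (ι - 1) ⊓ LinearMap.ker (Θ + 1) with hQ₁def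
  have hQ₁ : ∀ x, x ∈ Q₁ ↔ ι x = x ∧ Θ x = -x := fun x => by
    rw [hQ₁def, Submodule.mem_inf, LinearMap.mem_ker, LinearMap.mem_ker, LinearMap.sub_apply, Module.End.one_apply,
      sub_eq_zero, LinearMap.add_apply, Module.End.one_apply, add_eq_zero_iff_eq_neg]
  -- `B + Y` is injective on `Q₁` for every `Y` commuting with `ι`
  have hinj : ∀ Y : Module.End ℂ W, Y * ι = ι * Y → ∀ c ∈ Q₁, B c + Y c = 0 → c = 0 := by
    intro Y hYc c hc h
    obtain ⟨hιc, hΘc⟩ := (hQ₁ c).1 hc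
    have h2 : -(B c) + Y c = 0 := by
      have := congrArg ι h
      rwa [map_add, map_zero, hιB, ← Module.End.mul_apply, ← hYc, Module.End.mul_apply, hιc] at this
    have hBc : B c = 0 := by
      have e : B c = (2 : ℂ)⁻¹ • ((B c + Y c) - (-(B c) + Y c)) := by module
      rw [h, h2, sub_zero, smul_zero] at e
      exact e
    have hιc' := hιker c hΘc hBc
    rw [hιc] at hιc'
    have : (2 : ℂ) • c = 0 := by rw [two_smul]; nth_rewrite 2 [hιc']; rw [add_neg_cancel]
    exact (smul_eq_zero.1 this).resolve_left two_ne_zero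
  have hfinmap : ∀ Y : Module.End ℂ W, Y * ι = ι * Y →
      Module.finrank ℂ (Q₁.map (B + Y)) = Module.finrank ℂ Q₁ := by
    intro Y hYc
    have h := UnitaryLeviKernel.finrank_map_add_finrank_inf_ker (B + Y) Q₁
    have hbot : Q₁ ⊓ LinearMap.ker (B + Y) = ⊥ := by
      rw [Submodule.eq_bot_iff]
      intro c hc
      obtain ⟨hc1, hc2⟩ := Submodule.mem_inf.1 hc
      rw [LinearMap.mem_ker, LinearMap.add_apply] at hc2
      exact hinj Y hYc c hc1 hc2
    rw [hbot, finrank_bot, add_zero] at h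
    exact h
  -- `B(W) = B(Q₁)`, so `rk B = dim Q₁`
  have hsplitι : ∀ q, Θ q = -q →
      ι ((2 : ℂ)⁻¹ • (q + ι q)) = (2 : ℂ)⁻¹ • (q + ι q) ∧ Θ ((2 : ℂ)⁻¹ • (q + ι q)) = -((2 : ℂ)⁻¹ • (q + ι q)) ∧
      ι ((2 : ℂ)⁻¹ • (q - ι q)) = -((2 : ℂ)⁻¹ • (q - ι q)) ∧ Θ ((2 : ℂ)⁻¹ • (q - ι q)) = -((2 : ℂ)⁻¹ • (q - ι q)) ∧
      (2 : ℂ)⁻¹ • (q + ι q) + (2 : ℂ)⁻¹ • (q - ι q) = q := by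
    intro q hΘq
    have hΘιq : Θ (ι q) = -(ι q) := by rw [← hιΘv, hΘq, map_neg]
    refine ⟨?_, ?_, ?_, ?_, by module⟩
    · rw [map_smul, map_add, hιv, add_comm]
    · rw [map_smul, map_add, hΘιq, hΘq]; module
    · rw [map_smul, map_sub, hιv]; module
    · rw [map_smul, map_sub, hΘιq, hΘq]; module
  have hBQ₁ : LinearMap.range B = Q₁.map B := by
    apply le_antisymm
    · rintro _ ⟨w, rfl⟩
      set q : W := (2 : ℂ)⁻¹ • (w - Θ w) with hqdef
      have hΘq : Θ q = -q := by rw [hqdef, map_smul, map_sub, hΘΘv, ← smul_neg, neg_sub]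
      obtain ⟨hιpl, hΘpl, hιmi, hΘmi, hqsplit⟩ := hsplitι q hΘq
      have hqpl : (2 : ℂ)⁻¹ • (q + ι q) ∈ Q₁ := (hQ₁ _).2 ⟨hιpl, hΘpl⟩
      have hw : w = (2 : ℂ)⁻¹ • (w + Θ w) + q := by rw [hqdef]; module
      have hBw : B w = B ((2 : ℂ)⁻¹ • (q + ι q)) := by
        conv_lhs => rw [hw, map_add, hraiseP B hBΘ _ (by rw [map_smul, map_add, hΘΘv, add_comm]), zero_add,
          ← hqsplit, map_add, hkerB _ hιmi hΘmi, add_zero]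
      rw [hBw]
      exact Submodule.mem_map_of_mem hqpl
    · exact LinearMap.map_le_range
  have hfinB : Module.finrank ℂ (LinearMap.range B) = Module.finrank ℂ Q₁ := by
    have h := hfinmap 0 (by rw [zero_mul, mul_zero])
    rw [add_zero] at h
    rw [hBQ₁, h]
  -- (★) maximality: `Y q = B c`, `Y c = 0`
  have hstar : ∀ Y ∈ 𝔊, Θ * Y = Y → Y * Θ = -Y → Y * ι = ι * Y → ∀ q, ι q = -q → Θ q = -q →
      ∃ c ∈ Q₁, Y q = B c ∧ Y c = 0 := by
    intro Y hY hΘY hYΘ hYc q hιq hΘq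
    have hBY : B + Y ∈ 𝔊 := Submodule.add_mem _ hB hY
    have hΘBY : Θ * (B + Y) = B + Y := by rw [mul_add, hΘB, hΘY]
    have hBYΘ : (B + Y) * Θ = -(B + Y) := by rw [add_mul, hBΘ, hYΘ, neg_add]
    have hle := hmax (B + Y) hBY hΘBY hBYΘ
    have hmapeq : Q₁.map (B + Y) = LinearMap.range (B + Y) :=
      Submodule.eq_of_le_of_finrank_le LinearMap.map_le_range (by rw [hfinmap Y hYc, ← hfinB]; exact hle)
    have hq' : (B + Y) q ∈ Q₁.map (B + Y) := by rw [hmapeq]; exact LinearMap.mem_range_self _ q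
    obtain ⟨c, hc, hcq⟩ := Submodule.mem_map.1 hq'
    rw [LinearMap.add_apply, LinearMap.add_apply, hkerB q hιq hΘq, zero_add] at hcq
    obtain ⟨hιc, -⟩ := (hQ₁ c).1 hc
    have h2 : -(B c) + Y c = -(Y q) := by
      have := congrArg ι hcq
      rwa [map_add, hιB, ← Module.End.mul_apply, ← hYc, Module.End.mul_apply, hιc, ← Module.End.mul_apply,
        ← hYc, Module.End.mul_apply, hιq, map_neg] at this
    have hYc0 : Y c = 0 := by
      have e : Y c = (2 : ℂ)⁻¹ • ((B c + Y c) + (-(B c) + Y c)) := by module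
      rw [hcq, h2, add_neg_cancel, smul_zero] at e
      exact e
    have hBc : Y q = B c := by
      have e : B c = (2 : ℂ)⁻¹ • ((B c + Y c) - (-(B c) + Y c)) := by module
      rw [hcq, h2, sub_neg_eq_add] at e
      rw [e]; module
    exact ⟨c, hc, hBc, hYc0⟩
  -- the lift `X` of `e₂ ⊗ ψ` kills `Q ∩ U⁻`
  obtain ⟨ψ, hψ⟩ := Module.Projective.exists_dual_eq_one ℂ hc₁0
  obtain ⟨X, hX, hΘX, hXΘ, hXc, hXval⟩ := UnitaryLeviFull.exists_raise_lift hbr hΘ hΘΘ hιΘ hUp hfull ψ hΘe₂ hιe₂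
  have hX0 : ∀ q, ι q = -q → Θ q = -q → X q = 0 := by
    intro q hιq hΘq
    by_contra hXq
    obtain ⟨c, hc, hXqc, hXc0⟩ := hstar X hX hΘX hXΘ hXc q hιq hΘq
    obtain ⟨hιc', hΘc'⟩ := (hQ₁ c).1 hc
    rw [hXval c hιc' hΘc'] at hXc0
    have hc0 : c ≠ 0 := fun h => hXq (by rw [hXqc, h, map_zero])
    obtain ⟨ψ', hψ'⟩ := Module.Projective.exists_dual_eq_one ℂ hc0
    obtain ⟨X', hX', hΘX', hX'Θ, hX'c, hX'val⟩ :=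
      UnitaryLeviFull.exists_raise_lift hbr hΘ hΘΘ hιΘ hUp hfull ψ' hΘe₁ hιe₁
    obtain ⟨c', hc', hX'qc', hX'c'0⟩ := hstar X' hX' hΘX' hX'Θ hX'c q hιq hΘq
    obtain ⟨hιc'', hΘc''⟩ := (hQ₁ c').1 hc'
    rw [hX'val c' hιc'' hΘc''] at hX'c'0
    have hψ'c' : ψ' c' = 0 := (smul_eq_zero.1 hX'c'0).resolve_right he₁0
    have hS : X + X' ∈ 𝔊 := Submodule.add_mem _ hX hX'
    have hΘS : Θ * (X + X') = X + X' := by rw [mul_add, hΘX, hΘX']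
    have hSΘ : (X + X') * Θ = -(X + X') := by rw [add_mul, hXΘ, hX'Θ, neg_add]
    have hSc : (X + X') * ι = ι * (X + X') := by rw [add_mul, mul_add, hXc, hX'c]
    obtain ⟨d, hd, hSqd, hSd0⟩ := hstar (X + X') hS hΘS hSΘ hSc q hιq hΘq
    obtain ⟨hιd, hΘd⟩ := (hQ₁ d).1 hd
    rw [LinearMap.add_apply, hXval d hιd hΘd, hX'val d hιd hΘd, add_comm] at hSd0
    have h00 := (hind (ψ' d) (ψ d) hSd0).1
    rw [LinearMap.add_apply, hXqc, hX'qc', ← map_add] at hSqd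
    have hdc : d = c + c' := by
      have hmem : d - (c + c') ∈ Q₁ := Submodule.sub_mem _ hd (Submodule.add_mem _ hc hc')
      have h0 : B (d - (c + c')) + (0 : Module.End ℂ W) (d - (c + c')) = 0 := by
        rw [LinearMap.zero_apply, add_zero, map_sub, hSqd, sub_self]
      exact sub_eq_zero.1 (hinj 0 (by rw [zero_mul, mul_zero]) _ hmem h0)
    rw [hdc, map_add, hψ', hψ'c', add_zero] at h00
    exact one_ne_zero h00
  -- so `X = e₂ ⊗ ψ` has rank one
  have hXw : ∀ w, X w ∈ ℂ ∙ e₂ := by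
    intro w
    set q : W := (2 : ℂ)⁻¹ • (w - Θ w) with hqdef
    have hΘq : Θ q = -q := by rw [hqdef, map_smul, map_sub, hΘΘv, ← smul_neg, neg_sub]
    obtain ⟨hιpl, hΘpl, hιmi, hΘmi, hqsplit⟩ := hsplitι q hΘq
    have hw : w = (2 : ℂ)⁻¹ • (w + Θ w) + q := by rw [hqdef]; module
    have hXw : X w = ψ ((2 : ℂ)⁻¹ • (q + ι q)) • e₂ := by
      conv_lhs => rw [hw, map_add, hraiseP X hXΘ _ (by rw [map_smul, map_add, hΘΘv, add_comm]), zero_add,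
        ← hqsplit, map_add, hX0 _ hιmi hΘmi, add_zero, hXval _ hιpl hΘpl]
    rw [hXw]
    exact Submodule.smul_mem _ _ (Submodule.mem_span_singleton_self e₂)
  have hrange : LinearMap.range X = ℂ ∙ e₂ := by
    apply le_antisymm
    · rintro _ ⟨w, rfl⟩; exact hXw w
    · rw [Submodule.span_singleton_le_iff_mem]
      exact ⟨c₁, by rw [hXval c₁ hιc₁ hΘc₁, hψ, one_smul]⟩
  refine ⟨X, hX, hΘX, hXΘ, ?_⟩
  rw [hrange, finrank_span_singleton he₂0]

/-! ### §5 The maximality polarisation as a stand-alone identity -/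

/-- **The maximality polarisation (exported).** Let `B ∈ 𝔊` be raising of MAXIMAL rank and `ι` an involution commuting
with `Θ` with `B(W) ⊆ U⁻`, `Q ∩ U⁻ ⊆ ker B`, `Q ∩ ker B ⊆ U⁻` (the involution of `B`). Then for every raising `Y ∈ 𝔊`
commuting with `ι` and every `q ∈ Q ∩ U⁻` there is `c ∈ Q ∩ U⁺` with `Y q = B c` and `Y c = 0` (`B + Y` is injective
on `Q ∩ U⁺`, so `(B + Y)(Q ∩ U⁺) = (B + Y)(W)` by maximality). Polarising in `Y` gives
`Y B⁻¹ Y′|_{Q ∩ U⁻} + Y′ B⁻¹ Y|_{Q ∩ U⁻} = 0` on `Q ∩ U⁺`-components. (The engine of `exists_rankOne_raise_of_maxRank`,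
§4.) [cite: Ribet1983, Thm. 3] [cite: Deligne1982HodgeCycles, I §3 Prop. 3.4, 3.6] [cite: HoffmanKunze1971LinearAlgebra, §3.1 Thm. 2] -/
theorem UnitaryLeviFull.exists_apply_eq_of_maxRank [FiniteDimensional ℂ W] {𝔊 : Submodule ℂ (Module.End ℂ W)}
    {Θ : Module.End ℂ W} (hΘΘ : Θ * Θ = 1)
    {B : Module.End ℂ W} (hB : B ∈ 𝔊) (hΘB : Θ * B = B) (hBΘ : B * Θ = -B)
    (hmax : ∀ B' ∈ 𝔊, Θ * B' = B' → B' * Θ = -B' →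
      Module.finrank ℂ (LinearMap.range B') ≤ Module.finrank ℂ (LinearMap.range B))
    {ι : Module.End ℂ W} (hιι : ι * ι = 1) (hιΘ : ι * Θ = Θ * ι) (hιB : ∀ w, ι (B w) = -(B w))
    (hkerB : ∀ x, ι x = -x → Θ x = -x → B x = 0) (hιker : ∀ x, Θ x = -x → B x = 0 → ι x = -x)
    {Y : Module.End ℂ W} (hY : Y ∈ 𝔊) (hΘY : Θ * Y = Y) (hYΘ : Y * Θ = -Y) (hYc : Y * ι = ι * Y)
    {q : W} (hιq : ι q = -q) (hΘq : Θ q = -q) :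
    ∃ c, ι c = c ∧ Θ c = -c ∧ Y q = B c ∧ Y c = 0 := by
  classical
  have hΘΘv : ∀ v, Θ (Θ v) = v := fun v => by rw [← Module.End.mul_apply, hΘΘ, Module.End.one_apply]
  have hιv : ∀ v, ι (ι v) = v := fun v => by rw [← Module.End.mul_apply, hιι, Module.End.one_apply]
  have hιΘv : ∀ w, ι (Θ w) = Θ (ι w) := fun w => by rw [← Module.End.mul_apply, hιΘ, Module.End.mul_apply]
  have hraiseP : ∀ Z : Module.End ℂ W, Z * Θ = -Z → ∀ p, Θ p = p → Z p = 0 := fun Z hZΘ p hp => by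
    have h : Z p = -(Z p) := by
      conv_lhs => rw [← hp]
      rw [← Module.End.mul_apply, hZΘ, LinearMap.neg_apply]
    have h2 : (2 : ℂ) • Z p = 0 := by rw [two_smul]; nth_rewrite 2 [h]; rw [add_neg_cancel]
    exact (smul_eq_zero.1 h2).resolve_left two_ne_zero
  set Q₁ : Submodule ℂ W := LinearMap.ker (ι - 1) ⊓ LinearMap.ker (Θ + 1) with hQ₁def
  have hQ₁ : ∀ x, x ∈ Q₁ ↔ ι x = x ∧ Θ x = -x := fun x => by
    rw [hQ₁def, Submodule.mem_inf, LinearMap.mem_ker, LinearMap.mem_ker, LinearMap.sub_apply, Module.End.one_apply,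
      sub_eq_zero, LinearMap.add_apply, Module.End.one_apply, add_eq_zero_iff_eq_neg]
  -- `B + Z` is injective on `Q₁` for every `Z` commuting with `ι`
  have hinj : ∀ Z : Module.End ℂ W, Z * ι = ι * Z → ∀ c ∈ Q₁, B c + Z c = 0 → c = 0 := by
    intro Z hZc c hc h
    obtain ⟨hιc, hΘc⟩ := (hQ₁ c).1 hc
    have h2 : -(B c) + Z c = 0 := by
      have := congrArg ι h
      rwa [map_add, map_zero, hιB, ← Module.End.mul_apply, ← hZc, Module.End.mul_apply, hιc] at this
    have hBc : B c = 0 := by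
      have e : B c = (2 : ℂ)⁻¹ • ((B c + Z c) - (-(B c) + Z c)) := by module
      rw [h, h2, sub_zero, smul_zero] at e
      exact e
    have hιc' := hιker c hΘc hBc
    rw [hιc] at hιc'
    have : (2 : ℂ) • c = 0 := by rw [two_smul]; nth_rewrite 2 [hιc']; rw [add_neg_cancel]
    exact (smul_eq_zero.1 this).resolve_left two_ne_zero
  have hfinmap : ∀ Z : Module.End ℂ W, Z * ι = ι * Z →
      Module.finrank ℂ (Q₁.map (B + Z)) = Module.finrank ℂ Q₁ := by
    intro Z hZc
    have h := UnitaryLeviKernel.finrank_map_add_finrank_inf_ker (B + Z) Q₁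
    have hbot : Q₁ ⊓ LinearMap.ker (B + Z) = ⊥ := by
      rw [Submodule.eq_bot_iff]
      intro c hc
      obtain ⟨hc1, hc2⟩ := Submodule.mem_inf.1 hc
      rw [LinearMap.mem_ker, LinearMap.add_apply] at hc2
      exact hinj Z hZc c hc1 hc2
    rw [hbot, finrank_bot, add_zero] at h
    exact h
  -- `B(W) = B(Q₁)`
  have hBQ₁ : LinearMap.range B = Q₁.map B := by
    apply le_antisymm
    · rintro _ ⟨w, rfl⟩
      set q' : W := (2 : ℂ)⁻¹ • (w - Θ w) with hq'def
      have hΘq' : Θ q' = -q' := by rw [hq'def, map_smul, map_sub, hΘΘv, ← smul_neg, neg_sub]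
      have hΘιq' : Θ (ι q') = -(ι q') := by rw [← hιΘv, hΘq', map_neg]
      have hιpl : ι ((2 : ℂ)⁻¹ • (q' + ι q')) = (2 : ℂ)⁻¹ • (q' + ι q') := by rw [map_smul, map_add, hιv, add_comm]
      have hΘpl : Θ ((2 : ℂ)⁻¹ • (q' + ι q')) = -((2 : ℂ)⁻¹ • (q' + ι q')) := by
        rw [map_smul, map_add, hΘιq', hΘq']; module
      have hιmi : ι ((2 : ℂ)⁻¹ • (q' - ι q')) = -((2 : ℂ)⁻¹ • (q' - ι q')) := by rw [map_smul, map_sub, hιv]; module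
      have hΘmi : Θ ((2 : ℂ)⁻¹ • (q' - ι q')) = -((2 : ℂ)⁻¹ • (q' - ι q')) := by
        rw [map_smul, map_sub, hΘιq', hΘq']; module
      have hqsplit : (2 : ℂ)⁻¹ • (q' + ι q') + (2 : ℂ)⁻¹ • (q' - ι q') = q' := by module
      have hqpl : (2 : ℂ)⁻¹ • (q' + ι q') ∈ Q₁ := (hQ₁ _).2 ⟨hιpl, hΘpl⟩
      have hw : w = (2 : ℂ)⁻¹ • (w + Θ w) + q' := by rw [hq'def]; module
      have hBw : B w = B ((2 : ℂ)⁻¹ • (q' + ι q')) := by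
        conv_lhs => rw [hw, map_add, hraiseP B hBΘ _ (by rw [map_smul, map_add, hΘΘv, add_comm]), zero_add,
          ← hqsplit, map_add, hkerB _ hιmi hΘmi, add_zero]
      rw [hBw]
      exact Submodule.mem_map_of_mem hqpl
    · exact LinearMap.map_le_range
  have hfinB : Module.finrank ℂ (LinearMap.range B) = Module.finrank ℂ Q₁ := by
    have h := hfinmap 0 (by rw [zero_mul, mul_zero])
    rw [add_zero] at h
    rw [hBQ₁, h]
  -- maximality
  have hBY : B + Y ∈ 𝔊 := Submodule.add_mem _ hB hY
  have hΘBY : Θ * (B + Y) = B + Y := by rw [mul_add, hΘB, hΘY]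
  have hBYΘ : (B + Y) * Θ = -(B + Y) := by rw [add_mul, hBΘ, hYΘ, neg_add]
  have hle := hmax (B + Y) hBY hΘBY hBYΘ
  have hmapeq : Q₁.map (B + Y) = LinearMap.range (B + Y) :=
    Submodule.eq_of_le_of_finrank_le LinearMap.map_le_range (by rw [hfinmap Y hYc, ← hfinB]; exact hle)
  have hq' : (B + Y) q ∈ Q₁.map (B + Y) := by rw [hmapeq]; exact LinearMap.mem_range_self _ q
  obtain ⟨c, hc, hcq⟩ := Submodule.mem_map.1 hq'
  rw [LinearMap.add_apply, LinearMap.add_apply, hkerB q hιq hΘq, zero_add] at hcq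
  obtain ⟨hιc, hΘc⟩ := (hQ₁ c).1 hc
  have h2 : -(B c) + Y c = -(Y q) := by
    have := congrArg ι hcq
    rwa [map_add, hιB, ← Module.End.mul_apply, ← hYc, Module.End.mul_apply, hιc, ← Module.End.mul_apply,
      ← hYc, Module.End.mul_apply, hιq, map_neg] at this
  have hYc0 : Y c = 0 := by
    have e : Y c = (2 : ℂ)⁻¹ • ((B c + Y c) + (-(B c) + Y c)) := by module
    rw [hcq, h2, add_neg_cancel, smul_zero] at e
    exact e
  have hBc : Y q = B c := by
    have e : B c = (2 : ℂ)⁻¹ • ((B c + Y c) - (-(B c) + Y c)) := by module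
    rw [hcq, h2, sub_neg_eq_add] at e
    rw [e]; module
  exact ⟨c, hιc, hΘc, hBc, hYc0⟩

end HodgeStructure

end Literature.AlgebraicGeometry.Motives
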